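import Mathlib

/-!
# TropicalLinks / InductiveStep — transport of a stratum chart along a lattice splitting (brick T)

Route `ResolutionOfSingularities/TropicalLinks`, crux `InductiveStep`
(stmt-ResolutionOfSingularities-17233), line `split`, brick T of the valuative layer.

A *stratum chart* for an ideal `I ⊆ k[ℤ^n]` (with `𝒪 := k[ℤ^n] ⧸ I`) is a datum
`(A, ιA : A →ₐ[k] 𝒪, m : Fin l → A, a : ℤ^n →+ ℤ^l)` with `ιA` injective, `𝒪 = A[1/∏ m]`
(`hloc`), `a` surjective, every monomial `x^w` equal to a unit of `A` times `m^{a(w)}` (`hmon`), and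
the image of `A` generated by the monomials with `a(w) ≥ 0` (`hgen`).  After a change of torus
coordinates `e : ℤ^n ≃+ ℤ × K` the ideal becomes some `J ⊆ k[ℤ × K]`, and the induced `k`-algebra
isomorphism `φ : 𝒪 → 𝒪' := k[ℤ × K] ⧸ J` (given abstractly: bijective and sending the monomial
`x^u` to `x^{e u}`) transports the chart: `(A, φ ∘ ιA, m, a ∘ e⁻¹)` is a stratum chart for `J`.
This is pure bookkeeping (`tropicalLinks_stratumChart_transport`), consumed by the assembly of the
valuative layer.
-/

set_option linter.dupNamespace false -- single-problem summit: doubled namespace component is forced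

namespace Summit.ResolutionOfSingularities.ResolutionOfSingularities.Theorems

/-- **Transport of a stratum chart along a lattice splitting** (brick T): if `(A, ιA, m, a)` is a
stratum chart for `I ⊆ k[ℤ^n]` and `φ : k[ℤ^n] ⧸ I → k[ℤ × K] ⧸ J` is a bijective `k`-algebra map
sending `x^u ↦ x^{e u}` for a lattice isomorphism `e : ℤ^n ≃+ ℤ × K`, then
`(A, φ ∘ ιA, m, a ∘ e⁻¹)` is a stratum chart for `J`. [folklore] -/
theorem tropicalLinks_stratumChart_transport : ∀ (k : Type) [Field k] (n : ℕ) (I : Ideal (AddMonoidAlgebra k (Fin n → ℤ))) (K : Type) [AddCommGroup K] (e : (Fin n → ℤ) ≃+ ℤ × K) (J : Ideal (AddMonoidAlgebra k (ℤ × K))) (φ : (AddMonoidAlgebra k (Fin n → ℤ) ⧸ I) →ₐ[k] AddMonoidAlgebra k (ℤ × K) ⧸ J), Function.Bijective φ → (∀ u : Fin n → ℤ, φ (Ideal.Quotient.mk I (AddMonoidAlgebra.single u (1 : k))) = Ideal.Quotient.mk J (AddMonoidAlgebra.single (e u) (1 : k))) → ∀ (A : Type) [CommRing A] [Algebra k A]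 (ιA : A →ₐ[k] AddMonoidAlgebra k (Fin n → ℤ) ⧸ I) (l : ℕ) (m : Fin l → A) (a : (Fin n → ℤ) →+ (Fin l → ℤ)), Function.Injective ιA → (∀ y : AddMonoidAlgebra k (Fin n → ℤ) ⧸ I, ∃ (x : A) (t : ℕ), y * ιA (∏ i, m i) ^ t = ιA x) → Function.Surjective a → (∀ w : Fin n → ℤ, ∃ ε : Aˣ, Ideal.Quotient.mk I (AddMonoidAlgebra.single w (1 : k)) * ιA (∏ i, m i ^ (-(a w i)).toNat) = ιA ((ε : A) * ∏ i, m i ^ (a w i).toNat)) → ιA.range = Algebra.adjoin k {x : AddMonoidAlgebra k (Fin n → ℤ) ⧸ I | ∃ w : Fin n → ℤ, (∀ i, 0 ≤ a w i) ∧ x = Ideal.Quotient.mk I (AddMonoidAlgebra.single w (1 : k))} → Function.Injective (φ.comp ιA) ∧ (∀ y : AddMonoidAlgebra k (ℤ × K) ⧸ J, ∃ (x : A) (t : ℕ), y * (φ.comp ιA) (∏ i, m i) ^ t = (φ.comp ιA) x) ∧ Function.Surjective (a.comp e.symm.toAddMonoidHom) ∧ (∀ w : ℤ × K, ∃ ε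 : Aˣ, Ideal.Quotient.mk J (AddMonoidAlgebra.single w (1 : k)) * (φ.comp ιA) (∏ i, m i ^ (-((a.comp e.symm.toAddMonoidHom) w i)).toNat) = (φ.comp ιA) ((ε : A) * ∏ i, m i ^ ((a.comp e.symm.toAddMonoidHom) w i).toNat)) ∧ (φ.comp ιA).range = Algebra.adjoin k {x : AddMonoidAlgebra k (ℤ × K) ⧸ J | ∃ w : ℤ × K, (∀ i, 0 ≤ (a.comp e.symm.toAddMonoidHom) w i) ∧ x = Ideal.Quotient.mk J (AddMonoidAlgebra.single w (1 : k))} := by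
  intro k _ n I K _ e J φ hbij hφ A _ _ ιA l m a hinj hloc hsurj hmon hgen
  -- `φ` on the monomial with exponent `e⁻¹ w`
  have hφsymm : ∀ w : ℤ × K, φ (Ideal.Quotient.mk I (AddMonoidAlgebra.single (e.symm w) (1 : k))) =
      Ideal.Quotient.mk J (AddMonoidAlgebra.single w (1 : k)) := by
    intro w
    rw [hφ, AddEquiv.apply_symm_apply]
  refine ⟨hbij.1.comp hinj, ?_, hsurj.comp e.symm.surjective, ?_, ?_⟩
  · -- localisation: `𝒪' = (φ ∘ ιA)(A)[1/∏ m]`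
    intro y
    obtain ⟨y₀, rfl⟩ := hbij.2 y
    obtain ⟨x, t, hxt⟩ := hloc y₀
    refine ⟨x, t, ?_⟩
    have h := congrArg φ hxt
    rw [map_mul, map_pow] at h
    exact h
  · -- monomials: `x^w = unit ⬝ m^{a (e⁻¹ w)}`
    intro w
    obtain ⟨ε, hε⟩ := hmon (e.symm w)
    refine ⟨ε, ?_⟩
    have h := congrArg φ hε
    rw [map_mul, hφsymm] at h
    exact h
  · -- generation by the non-negative monomials
    rw [AlgHom.range_comp, hgen, AlgHom.map_adjoin]
    congr 1
    ext x
    simp only [Set.mem_image, Set.mem_setOf_eq]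
    constructor
    · rintro ⟨y, ⟨w, hw, rfl⟩, rfl⟩
      refine ⟨e w, fun i => ?_, hφ w⟩
      show 0 ≤ a (e.symm (e w)) i
      rw [AddEquiv.symm_apply_apply]
      exact hw i
    · rintro ⟨w, hw, rfl⟩
      exact ⟨_, ⟨e.symm w, hw, rfl⟩, hφsymm w⟩

end Summit.ResolutionOfSingularities.ResolutionOfSingularities.Theorems
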